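import Mathlib

set_option linter.dupNamespace false

/-!
# Stub `stub_blockTPP` — generic single-block triple product property

Crux `stmt-MatrixMultiplication-10595` (`Theses.ThinBlockAlpha.ThinPackings`), line
`log-flat-cyclic-designs`.

If the seven products `x y ζ, x ξ z, x ξ ζ, y z, y ζ, ξ z, ξ ζ` of a field `F` that is an algebra over
`ZMod p` are `ZMod p`-linearly independent, then the box map
`(τ, σ, ρ) ↦ (x + τ)(y + ξ σ)(z + ζ ρ)` is injective on `(ZMod p)³`.

Proof: expanding, `(x + τ)(y + ξσ)(z + ζρ) = x y z + ρ • (x y ζ) + σ • (x ξ z) + (σρ) • (x ξ ζ)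
+ τ • (y z) + (τρ) • (y ζ) + (τσ) • (ξ z) + (τσρ) • (ξ ζ)`, so an equality of two box products is a
`ZMod p`-linear relation among the seven products with coefficients
`ρ' - ρ, σ' - σ, σ'ρ' - σρ, τ' - τ, τ'ρ' - τρ, τ'σ' - τσ, τ'σ'ρ' - τσρ`; linear independence kills all
of them, and the coordinates `3, 1, 0` give `τ = τ'`, `σ = σ'`, `ρ = ρ'`.
-/

namespace Summit.MatrixMultiplication.MatrixMultiplication.Theorems.ThinPackings

/-- **Generic single-block TPP.**  If the seven products
`x y ζ, x ξ z, x ξ ζ, y z, y ζ, ξ z, ξ ζ` are `ZMod p`-linearly independent then the box map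
`(τ, σ, ρ) ↦ (x+τ)(y+ξσ)(z+ζρ)` is injective on `(ZMod p)³`. -/
theorem stub_blockTPP :
    ∀ (p : ℕ) (F : Type) [Field F] [Algebra (ZMod p) F] (x y z ξ ζ : F),
      LinearIndependent (ZMod p) ![x * y * ζ, x * ξ * z, x * ξ * ζ, y * z, y * ζ, ξ * z, ξ * ζ] →
      ∀ τ τ' σ σ' ρ ρ' : ZMod p,
        (x + algebraMap (ZMod p) F τ') * (y + ξ * algebraMap (ZMod p) F σ') *
            (z + ζ * algebraMap (ZMod p) F ρ') =
          (x + algebraMap (ZMod p) F τ) * (y + ξ * algebraMap (ZMod p) F σ) *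
            (z + ζ * algebraMap (ZMod p) F ρ) →
        τ = τ' ∧ σ = σ' ∧ ρ = ρ' := by
  intro p F _ _ x y z ξ ζ hli τ τ' σ σ' ρ ρ' E
  -- the coefficient vector of the linear relation produced by `E`
  set c : Fin 7 → ZMod p :=
    ![ρ' - ρ, σ' - σ, σ' * ρ' - σ * ρ, τ' - τ, τ' * ρ' - τ * ρ, τ' * σ' - τ * σ,
      τ' * σ' * ρ' - τ * σ * ρ] with hc
  have key : ∑ t, c t • ![x * y * ζ, x * ξ * z, x * ξ * ζ, y * z, y * ζ, ξ * z, ξ * ζ] t = 0 := by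
    rw [Fin.sum_univ_seven]
    simp only [hc, Matrix.cons_val_zero, Matrix.cons_val_one, Matrix.cons_val, Algebra.smul_def,
      map_sub, map_mul]
    linear_combination E
  have hzero := Fintype.linearIndependent_iff.1 hli c key
  have h3 : τ' - τ = 0 := by simpa [hc] using hzero 3
  have h1 : σ' - σ = 0 := by simpa [hc] using hzero 1
  have h0 : ρ' - ρ = 0 := by simpa [hc] using hzero 0
  exact ⟨(sub_eq_zero.1 h3).symm, (sub_eq_zero.1 h1).symm, (sub_eq_zero.1 h0).symm⟩

end Summit.MatrixMultiplication.MatrixMultiplication.Theorems.ThinPackings
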